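import Summits.AtomisticToContinuum.FouriersLaw.Theses.PuiseuxTransferLedger
import Summits.AtomisticToContinuum.FouriersLaw.Theorems.PhononMeanFreePathBoundaryKubo
import Summits.AtomisticToContinuum.FouriersLaw.Theorems.PuiseuxTransferLedgerTwoModeBulkStubProfileTTCF
import Summits.AtomisticToContinuum.FouriersLaw.Theorems.PuiseuxTransferLedgerTwoModeBulkStubProfileLimitExchange
import Summits.AtomisticToContinuum.FouriersLaw.Theorems.PuiseuxTransferLedgerTwoModeBulkStubProfileSumRule
import Summits.AtomisticToContinuum.FouriersLaw.Theorems.PuiseuxTransferLedgerTwoModeBulkGlue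

/-!
# The lossless reduction of crux `PuiseuxTransferLedger.TwoModeBulk` to the two-mode property of one explicit
equilibrium profile
(stub `twoModeBulk_iff_twoModeProfile` of line `Sketch`, crux stmt-AtomisticToContinuum-12111, plus the rider
`twoModeBulk_of_stubs`)

For `P = pinnedChain ω₂ lam β γ` (all four `> 0`) with `N + 1` sites, `T > 0`, `μ₀ = gibbsMeasure (N+1) T`,
`K_t = transitionKernel (N+1) T T t`, write `Y_i(t) = Cov_{μ₀}(p_0², K_t p_i²)`, `X_i(t) = Cov_{μ₀}(p_N², K_t p_i²)`,
`u_N(i) = (γ/T²)∫₀^∞ Y_i - 1/2` (the cut-bond form of the kinetic-temperature response) and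
`g_N = (γ²/T²)∫₀^∞ Y_N` (the per-bond conductance `D_{N+1}/N`).

FIXED `N` (all landed): along any steady family under weak-NESS uniqueness the crux's response limits EXIST and are
explicit — the current quotient tends to `kuboValue = N g_N` (`boundaryKubo_proof`), the profile quotient at site `i`
tends to `(γ/2T²)(∫₀^∞ Y_i - ∫₀^∞ X_i)` (`stub_profileLimitExchange stub_profileTTCF`, the subtracted equilibrium value
being `μ_{N+1,T,T}(p_i²) = T`), which is `u_N(i)` by the sum rule `∫₀^∞ Y_i + ∫₀^∞ X_i = T²/γ` (`stub_profileSumRule`).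
Limits along `𝓝[≠] 0` are unique, so the crux's `d`, `t i` ARE `kuboValue`, `u_N(i)`, and the crux at `N + 1` sites is
VERBATIM the two-mode inequality `|u_N(i) - u_N(i+1) - r g_N| ≤ C |g_N| (θ^i + θ^(N-1-i))` (`(N+1) - 1 = N`,
`(N+1) - 2 - i = N - 1 - i`). Conversely, instantiating the crux at a steady family chosen from
`pinnedChain_exists_isSteadyState` and at the proved uniqueness `NessUnique_holds` returns the two-mode inequality:
the reduction is LOSSLESS (`twoModeBulk_iff_twoModeProfile`). Rider (`twoModeBulk_of_stubs`): layer relaxation of the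
second differences of `u_N` + an exponentially accurate mid-chain slope give the crux, through the abstract glue
`twoMode_glue` (`Theorems/PuiseuxTransferLedgerTwoModeBulkGlue.lean`). No definitions.
-/

noncomputable section

open scoped NNReal ENNReal Topology
open MeasureTheory Filter Set

namespace Summit.AtomisticToContinuum.FouriersLaw.Theorems.TwoModeBulk.Sketch

open Literature.MathematicalPhysics.KineticTheory.HeatConduction
open Summit.AtomisticToContinuum.FouriersLaw.Theorems.BoundaryKubo.Negative.LoadBearing
  (kuboIntegrand kuboValue UniqueSteady SteadyFamily boundaryKubo_iff steadyFamily_apply_self)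
open Summit.AtomisticToContinuum.FouriersLaw.Theorems.PhononMeanFreePathBoundaryKubo (boundaryKubo_proof)
open Summit.AtomisticToContinuum.FouriersLaw.Theorems.IncoherentBounded (integral_momentum_sq_gibbsMeasure)

/-! ## Fixed-`N` identification of the response limits -/

/-- Under uniqueness the equal-temperature member of a steady family is the Gibbs state, whose kinetic temperature is
`T` at every site. [folklore] -/
theorem integral_sq_momentum_family_self {ω₂ lam β γ : ℝ} (hω : 0 < ω₂) (hl : 0 < lam) (hβ : 0 < β)
    (hU : UniqueSteady ω₂ lam β γ) {μ : (M : ℕ) → ℝ → ℝ → Measure (PhaseSpace M)}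
    (hμ : SteadyFamily ω₂ lam β γ μ) {T : ℝ} (hT : 0 < T) (M : ℕ) (i : Fin M) :
    ∫ x, (x.2 i) ^ 2 ∂(μ M T T) = T := by
  rw [steadyFamily_apply_self hω hl hβ hU hμ hT M]
  exact integral_momentum_sq_gibbsMeasure hω hl.le hβ hT M i

/-- The cut-bond algebra: if `A + B = T²/γ` then `(γ/2T²)(A - B) = (γ/T²)A - 1/2`. [folklore] -/
theorem cutBond_algebra {γ T A B : ℝ} (hγ : γ ≠ 0) (hT : T ≠ 0) (h : A + B = T ^ 2 / γ) :
    γ / (2 * T ^ 2) * (A - B) = γ / T ^ 2 * A - 1 / 2 := by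
  have hB : B = T ^ 2 / γ - A := by linarith
  rw [hB]
  field_simp
  ring

/-- **The profile response exists and is the cut-bond value `u_N(i) = (γ/T²)∫₀^∞ Y_i - 1/2`** (landed stubs
`stub_profileTTCF`, `stub_profileLimitExchange`, `stub_profileSumRule`, read in the crux's normalisation: the
subtracted equilibrium value `μ_{N+1,T,T}(p_i²)` is `T`). [folklore] -/
theorem tendsto_profileValue {ω₂ lam β γ : ℝ} (hω : 0 < ω₂) (hl : 0 < lam) (hβ : 0 < β) (hγ : 0 < γ)
    (hU : UniqueSteady ω₂ lam β γ) {μ : (M : ℕ) → ℝ → ℝ → Measure (PhaseSpace M)}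
    (hμ : SteadyFamily ω₂ lam β γ μ) {T : ℝ} (hT : 0 < T) (N : ℕ) (i : Fin (N + 1)) :
    Tendsto (fun δ : ℝ => ((∫ x, (x.2 i) ^ 2 ∂(μ (N + 1) (T + δ / 2) (T - δ / 2))) -
        ∫ x, (x.2 i) ^ 2 ∂(μ (N + 1) T T)) / δ) (𝓝[≠] 0)
      (𝓝 (γ / T ^ 2 * (∫ t in Set.Ioi (0 : ℝ),
            ((∫ z, (z.2 0) ^ 2 * (∫ y, (y.2 i) ^ 2
              ∂((pinnedChain ω₂ lam β γ).transitionKernel (N + 1) T T t.toNNReal z))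
              ∂((pinnedChain ω₂ lam β γ).gibbsMeasure (N + 1) T)) -
            (∫ z, (z.2 0) ^ 2 ∂((pinnedChain ω₂ lam β γ).gibbsMeasure (N + 1) T)) *
              (∫ z, (∫ y, (y.2 i) ^ 2
                ∂((pinnedChain ω₂ lam β γ).transitionKernel (N + 1) T T t.toNNReal z))
                ∂((pinnedChain ω₂ lam β γ).gibbsMeasure (N + 1) T)))) - 1 / 2)) := by
  have h := stub_profileLimitExchange stub_profileTTCF ω₂ lam β γ hω hl hβ hγ hU μ hμ T hT N i
  obtain ⟨-, -, hsum⟩ := stub_profileSumRule ω₂ lam β γ hω hl hβ hγ N T hT i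
  rw [cutBond_algebra hγ.ne' hT.ne' hsum] at h
  rw [integral_sq_momentum_family_self hω hl hβ hU hμ hT (N + 1) i]
  exact h

/-- The response coefficient of the `(N+1)`-site chain along the family is `kuboValue` (`boundaryKubo_proof`), hence
any limit `d` of the crux's current quotient IS `kuboValue`. [folklore] -/
theorem eq_kuboValue_of_tendsto {ω₂ lam β γ : ℝ} (hω : 0 < ω₂) (hl : 0 < lam) (hβ : 0 < β) (hγ : 0 < γ)
    (hU : UniqueSteady ω₂ lam β γ) {μ : (M : ℕ) → ℝ → ℝ → Measure (PhaseSpace M)}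
    (hμ : SteadyFamily ω₂ lam β γ μ) {T : ℝ} (hT : 0 < T) (N : ℕ) {d : ℝ}
    (hd : Tendsto (fun δ : ℝ =>
        (pinnedChain ω₂ lam β γ).totalCurrent (μ (N + 1) (T + δ / 2) (T - δ / 2)) / δ) (𝓝[≠] 0) (𝓝 d)) :
    d = kuboValue ω₂ lam β γ T N := by
  have hK := (boundaryKubo_iff.mp boundaryKubo_proof ω₂ lam β γ hω hl hβ hγ hU μ hμ T hT N).2
  exact tendsto_nhds_unique hd hK

/-- `kuboValue / N` is the per-bond conductance `g_N = (γ²/T²)∫₀^∞ Y_N` when `N ≠ 0`. [folklore] -/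
theorem kuboValue_div (ω₂ lam β γ T : ℝ) {N : ℕ} (hN : N ≠ 0) :
    kuboValue ω₂ lam β γ T N / (N : ℝ) =
      (γ ^ 2 / T ^ 2) * ∫ t in Set.Ioi (0 : ℝ), kuboIntegrand ω₂ lam β γ T N t := by
  have hMne : (N : ℝ) ≠ 0 := by exact_mod_cast hN
  unfold kuboValue
  field_simp

/-- A steady family by choice from the landed existence theorem `pinnedChain_exists_isSteadyState` (junk `0`
outside positive temperatures). [folklore] -/
theorem exists_steadyFamily {ω₂ lam β γ : ℝ} (hω : 0 < ω₂) (hl : 0 < lam) (hβ : 0 < β) (hγ : 0 < γ) :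
    ∃ μ : (M : ℕ) → ℝ → ℝ → Measure (PhaseSpace M), SteadyFamily ω₂ lam β γ μ := by
  have hfam : ∀ (M : ℕ) (a b : ℝ), ∃ ν : Measure (PhaseSpace M),
      (0 < a → 0 < b → (pinnedChain ω₂ lam β γ).IsSteadyState M a b ν) := by
    intro M a b
    by_cases h : 0 < a ∧ 0 < b
    · obtain ⟨ν, hν⟩ := pinnedChain_exists_isSteadyState hω hl hβ hγ M h.1 h.2
      exact ⟨ν, fun _ _ => hν⟩
    · exact ⟨0, fun ha hb => absurd ⟨ha, hb⟩ h⟩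
  choose μ hμ using hfam
  exact ⟨μ, fun M a b ha hb => hμ M a b ha hb⟩

/-! ## The registered sub-goal: the reduction is lossless -/

/-- **STUB `twoModeBulk_iff_twoModeProfile` of line `Sketch`: the crux `PuiseuxTransferLedger.TwoModeBulk` is
EQUIVALENT to the two-mode property of the explicit equilibrium profile.** With `u_N(i) = (γ/T²)∫₀^∞ Y_i - 1/2`,
`g_N = (γ²/T²)∫₀^∞ Y_N` (`Y_i(t) = Cov_{μ₀}(p_0², K_t p_i²)` for the `(N+1)`-site open equilibrium chain): the crux
holds iff for every admissible parameter point and `T > 0` there are `r`, `θ ∈ [0,1)`, `C` independent of `N` with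
`|u_N(i) - u_N(i+1) - r g_N| ≤ C |g_N| (θ^i + θ^(N-1-i))` for all `N` and all bonds. (→): instantiate the crux at a
steady family chosen from `pinnedChain_exists_isSteadyState` and at `NessUnique_holds`; its `d`, `t` may be taken to
be `kuboValue = N g_N` (`boundaryKubo_proof`) and `u_N` (`tendsto_profileValue`). (←): limits along `𝓝[≠] 0` are
unique, so any `d`, `t` of the crux ARE these values; `(N+1) - 1 = N`, `(N+1) - 2 - i = N - 1 - i`. [folklore] -/
theorem twoModeBulk_iff_twoModeProfile : Summit.AtomisticToContinuum.FouriersLaw.Theses.PuiseuxTransferLedger.TwoModeBulk ↔ (∀ ω₂ lam β γ : ℝ, 0 < ω₂ → 0 < lam → 0 < β → 0 < γ → ∀ T : ℝ, 0 < T → ∃ r θ C : ℝ, 0 ≤ θ ∧ θ < 1 ∧ ∀ (N : ℕ) (i j : Fin (N + 1)), j.val = i.val + 1 → |(γ / T ^ 2 * (∫ t in Set.Ioi (0 : ℝ), ((∫ z, (z.2 0) ^ 2 * (∫ y, (y.2 i) ^ 2 ∂((Literature.MathematicalPhysics.KineticTheory.HeatConduction.pinnedChain ω₂ lam β γ).transitionKernel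 (N + 1) T T t.toNNReal z)) ∂((Literature.MathematicalPhysics.KineticTheory.HeatConduction.pinnedChain ω₂ lam β γ).gibbsMeasure (N + 1) T)) - (∫ z, (z.2 0) ^ 2 ∂((Literature.MathematicalPhysics.KineticTheory.HeatConduction.pinnedChain ω₂ lam β γ).gibbsMeasure (N + 1) T)) * (∫ z, (∫ y, (y.2 i) ^ 2 ∂((Literature.MathematicalPhysics.KineticTheory.HeatConduction.pinnedChain ω₂ lam β γ).transitionKernel (N + 1) T T t.toNNReal z)) ∂((Literature.MathematicalPhysics.KineticTheory.HeatConduction.pinnedChain ω₂ lam β γ).gibbsMeasure (N + 1) T)))) - 1 / 2) - (γ / T ^ 2 * (∫ t in Set.Ioi (0 : ℝ), ((∫ z, (z.2 0) ^ 2 * (∫ y, (y.2 j) ^ 2 ∂((Literature.MathematicalPhysics.KineticTheory.HeatConduction.pinnedChain ω₂ lam β γ).transitionKernel (N + 1) T T t.toNNReal z)) ∂((Literature.MathematicalPhysics.KineticTheory.HeatConduction.pinnedChain ω₂ lam β γ).gibbsMeasure (N + 1) T)) - (∫ z, (z.2 0) ^ 2 ∂((Literature.MathematicalPhysics.KineticTheory.HeatConduction.pinnedChain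 ω₂ lam β γ).gibbsMeasure (N + 1) T)) * (∫ z, (∫ y, (y.2 j) ^ 2 ∂((Literature.MathematicalPhysics.KineticTheory.HeatConduction.pinnedChain ω₂ lam β γ).transitionKernel (N + 1) T T t.toNNReal z)) ∂((Literature.MathematicalPhysics.KineticTheory.HeatConduction.pinnedChain ω₂ lam β γ).gibbsMeasure (N + 1) T)))) - 1 / 2) - r * ((γ ^ 2 / T ^ 2) * ∫ t in Set.Ioi (0 : ℝ), ((∫ z, (z.2 0) ^ 2 * (∫ y, (y.2 (Fin.last N)) ^ 2 ∂((Literature.MathematicalPhysics.KineticTheory.HeatConduction.pinnedChain ω₂ lam β γ).transitionKernel (N + 1) T T t.toNNReal z)) ∂((Literature.MathematicalPhysics.KineticTheory.HeatConduction.pinnedChain ω₂ lam β γ).gibbsMeasure (N + 1) T)) - (∫ z, (z.2 0) ^ 2 ∂((Literature.MathematicalPhysics.KineticTheory.HeatConduction.pinnedChain ω₂ lam β γ).gibbsMeasure (N + 1) T)) * (∫ z, (∫ y, (y.2 (Fin.last N)) ^ 2 ∂((Literature.MathematicalPhysics.KineticTheory.HeatConduction.pinnedChain ω₂ lam β γ).transitionKernel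 (N + 1) T T t.toNNReal z)) ∂((Literature.MathematicalPhysics.KineticTheory.HeatConduction.pinnedChain ω₂ lam β γ).gibbsMeasure (N + 1) T))))| ≤ C * |(γ ^ 2 / T ^ 2) * ∫ t in Set.Ioi (0 : ℝ), ((∫ z, (z.2 0) ^ 2 * (∫ y, (y.2 (Fin.last N)) ^ 2 ∂((Literature.MathematicalPhysics.KineticTheory.HeatConduction.pinnedChain ω₂ lam β γ).transitionKernel (N + 1) T T t.toNNReal z)) ∂((Literature.MathematicalPhysics.KineticTheory.HeatConduction.pinnedChain ω₂ lam β γ).gibbsMeasure (N + 1) T)) - (∫ z, (z.2 0) ^ 2 ∂((Literature.MathematicalPhysics.KineticTheory.HeatConduction.pinnedChain ω₂ lam β γ).gibbsMeasure (N + 1) T)) * (∫ z, (∫ y, (y.2 (Fin.last N)) ^ 2 ∂((Literature.MathematicalPhysics.KineticTheory.HeatConduction.pinnedChain ω₂ lam β γ).transitionKernel (N + 1) T T t.toNNReal z)) ∂((Literature.MathematicalPhysics.KineticTheory.HeatConduction.pinnedChain ω₂ lam β γ).gibbsMeasure (N + 1) T)))| * (θ ^ i.val + θ ^ (N - 1 -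 i.val))) := by
  constructor
  · -- (→): the crux at a chosen steady family and the proved uniqueness
    intro hTM ω₂ lam β γ hω hl hβ hγ T hT
    have hU : UniqueSteady ω₂ lam β γ :=
      Summit.AtomisticToContinuum.FouriersLaw.Theses.PuiseuxTransferLedger.NessUnique_holds ω₂ lam β γ hω hl hβ hγ
    obtain ⟨μ, hμ⟩ := exists_steadyFamily hω hl hβ hγ
    obtain ⟨r, θ, C, h0, h1, hmain⟩ := hTM ω₂ lam β γ hω hl hβ hγ hU μ hμ T hT
    refine ⟨r, θ, C, h0, h1, fun N i j hij => ?_⟩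
    -- the crux at `N + 1` sites with the explicit limits
    have hd := (boundaryKubo_iff.mp boundaryKubo_proof ω₂ lam β γ hω hl hβ hγ hU μ hμ T hT N).2
    have h := hmain (N + 1) (kuboValue ω₂ lam β γ T N) _ hd
      (fun k => tendsto_profileValue hω hl hβ hγ hU hμ hT N k) i j hij
    have hcast : ((N + 1 : ℕ) : ℝ) - 1 = (N : ℝ) := by push_cast; ring
    have hsub : N + 1 - 2 - i.val = N - 1 - i.val := by omega
    rw [hcast, hsub] at h
    rcases Nat.eq_zero_or_pos N with hN | hN
    · subst hN
      exact absurd hij (by omega)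
    · rw [kuboValue_div ω₂ lam β γ T hN.ne'] at h
      exact h
  · -- (←): limits along `𝓝[≠] 0` are unique
    intro h4 ω₂ lam β γ hω hl hβ hγ hU μ hμ T hT
    obtain ⟨r, θ, C, hθ0, hθ1, hlayer⟩ := h4 ω₂ lam β γ hω hl hβ hγ T hT
    refine ⟨r, θ, C, hθ0, hθ1, ?_⟩
    intro N d t hd ht i j hij
    cases N with
    | zero => exact i.elim0
    | succ M =>
      -- identification of the limits with the explicit values
      have hdK : d = kuboValue ω₂ lam β γ T M := eq_kuboValue_of_tendsto hω hl hβ hγ hU hμ hT M hd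
      have hti := tendsto_nhds_unique (ht i) (tendsto_profileValue hω hl hβ hγ hU hμ hT M i)
      have htj := tendsto_nhds_unique (ht j) (tendsto_profileValue hω hl hβ hγ hU hμ hT M j)
      have hcast : ((M + 1 : ℕ) : ℝ) - 1 = (M : ℝ) := by push_cast; ring
      have hsub : M + 1 - 2 - i.val = M - 1 - i.val := by omega
      rw [hti, htj, hdK, hcast, hsub]
      have hl' := hlayer M i j hij
      -- `kuboValue / M` is the per-bond conductance when `M ≠ 0`; for `M = 0` there is no bond
      rcases Nat.eq_zero_or_pos M with hM | hM
      · subst hM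
        exact absurd hij (by omega)
      · rw [kuboValue_div ω₂ lam β γ T hM.ne']
        exact hl'

/-! ## Rider: the two `N`-uniform stubs of line `Sketch` give the crux by name -/

/-- **`twoModeBulk_of_stubs`**: LAYER RELAXATION (geometric decay of the second differences of the explicit profile
`u_N` from both contacts, amplitude `O(g_N)`, constants independent of `N` — stub `stub_layerRelaxation`) and BULK
SLOPE (the mid-chain increment is `r g_N` up to `O(g_N θ^N)` — stub `stub_bulkSlope`) give the crux
`PuiseuxTransferLedger.TwoModeBulk`: the abstract glue `twoMode_glue` at `u := u_N`, `g := g_N` yields the two-mode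
property of the profile, and `twoModeBulk_iff_twoModeProfile` converts it into the crux. [folklore] -/
theorem twoModeBulk_of_stubs :
    (∀ ω₂ lam β γ : ℝ, 0 < ω₂ → 0 < lam → 0 < β → 0 < γ → ∀ T : ℝ, 0 < T →
      ∃ θ C : ℝ, 0 ≤ θ ∧ θ < 1 ∧ ∀ (N : ℕ) (i j k : Fin (N + 1)), j.val = i.val + 1 → k.val = i.val + 2 →
        |(γ / T ^ 2 * (∫ t in Set.Ioi (0 : ℝ),
            ((∫ z, (z.2 0) ^ 2 * (∫ y, (y.2 i) ^ 2
              ∂((Literature.MathematicalPhysics.KineticTheory.HeatConduction.pinnedChain ω₂ lam β γ).transitionKernel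
                (N + 1) T T t.toNNReal z))
              ∂((Literature.MathematicalPhysics.KineticTheory.HeatConduction.pinnedChain ω₂ lam β γ).gibbsMeasure
                (N + 1) T)) -
            (∫ z, (z.2 0) ^ 2
              ∂((Literature.MathematicalPhysics.KineticTheory.HeatConduction.pinnedChain ω₂ lam β γ).gibbsMeasure
                (N + 1) T)) *
              (∫ z, (∫ y, (y.2 i) ^ 2
                ∂((Literature.MathematicalPhysics.KineticTheory.HeatConduction.pinnedChain ω₂ lam β γ).transitionKernel
                  (N + 1) T T t.toNNReal z))
                ∂((Literature.MathematicalPhysics.KineticTheory.HeatConduction.pinnedChain ω₂ lam β γ).gibbsMeasure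
                  (N + 1) T)))) - 1 / 2) -
          2 * (γ / T ^ 2 * (∫ t in Set.Ioi (0 : ℝ),
            ((∫ z, (z.2 0) ^ 2 * (∫ y, (y.2 j) ^ 2
              ∂((Literature.MathematicalPhysics.KineticTheory.HeatConduction.pinnedChain ω₂ lam β γ).transitionKernel
                (N + 1) T T t.toNNReal z))
              ∂((Literature.MathematicalPhysics.KineticTheory.HeatConduction.pinnedChain ω₂ lam β γ).gibbsMeasure
                (N + 1) T)) -
            (∫ z, (z.2 0) ^ 2
              ∂((Literature.MathematicalPhysics.KineticTheory.HeatConduction.pinnedChain ω₂ lam β γ).gibbsMeasure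
                (N + 1) T)) *
              (∫ z, (∫ y, (y.2 j) ^ 2
                ∂((Literature.MathematicalPhysics.KineticTheory.HeatConduction.pinnedChain ω₂ lam β γ).transitionKernel
                  (N + 1) T T t.toNNReal z))
                ∂((Literature.MathematicalPhysics.KineticTheory.HeatConduction.pinnedChain ω₂ lam β γ).gibbsMeasure
                  (N + 1) T)))) - 1 / 2) +
          (γ / T ^ 2 * (∫ t in Set.Ioi (0 : ℝ),
            ((∫ z, (z.2 0) ^ 2 * (∫ y, (y.2 k) ^ 2
              ∂((Literature.MathematicalPhysics.KineticTheory.HeatConduction.pinnedChain ω₂ lam β γ).transitionKernel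
                (N + 1) T T t.toNNReal z))
              ∂((Literature.MathematicalPhysics.KineticTheory.HeatConduction.pinnedChain ω₂ lam β γ).gibbsMeasure
                (N + 1) T)) -
            (∫ z, (z.2 0) ^ 2
              ∂((Literature.MathematicalPhysics.KineticTheory.HeatConduction.pinnedChain ω₂ lam β γ).gibbsMeasure
                (N + 1) T)) *
              (∫ z, (∫ y, (y.2 k) ^ 2
                ∂((Literature.MathematicalPhysics.KineticTheory.HeatConduction.pinnedChain ω₂ lam β γ).transitionKernel
                  (N + 1) T T t.toNNReal z))
                ∂((Literature.MathematicalPhysics.KineticTheory.HeatConduction.pinnedChain ω₂ lam β γ).gibbsMeasure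
                  (N + 1) T)))) - 1 / 2)| ≤
        C * |((γ ^ 2 / T ^ 2) * ∫ t in Set.Ioi (0 : ℝ),
            Summit.AtomisticToContinuum.FouriersLaw.Theorems.BoundaryKubo.Negative.LoadBearing.kuboIntegrand
              ω₂ lam β γ T N t)| * (θ ^ i.val + θ ^ (N - 2 - i.val))) →
    (∀ ω₂ lam β γ : ℝ, 0 < ω₂ → 0 < lam → 0 < β → 0 < γ → ∀ T : ℝ, 0 < T →
      ∃ r θ C : ℝ, 0 ≤ θ ∧ θ < 1 ∧ ∀ (N : ℕ) (i j : Fin (N + 1)), i.val = N / 2 → j.val = i.val + 1 →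
        |(γ / T ^ 2 * (∫ t in Set.Ioi (0 : ℝ),
            ((∫ z, (z.2 0) ^ 2 * (∫ y, (y.2 i) ^ 2
              ∂((Literature.MathematicalPhysics.KineticTheory.HeatConduction.pinnedChain ω₂ lam β γ).transitionKernel
                (N + 1) T T t.toNNReal z))
              ∂((Literature.MathematicalPhysics.KineticTheory.HeatConduction.pinnedChain ω₂ lam β γ).gibbsMeasure
                (N + 1) T)) -
            (∫ z, (z.2 0) ^ 2
              ∂((Literature.MathematicalPhysics.KineticTheory.HeatConduction.pinnedChain ω₂ lam β γ).gibbsMeasure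
                (N + 1) T)) *
              (∫ z, (∫ y, (y.2 i) ^ 2
                ∂((Literature.MathematicalPhysics.KineticTheory.HeatConduction.pinnedChain ω₂ lam β γ).transitionKernel
                  (N + 1) T T t.toNNReal z))
                ∂((Literature.MathematicalPhysics.KineticTheory.HeatConduction.pinnedChain ω₂ lam β γ).gibbsMeasure
                  (N + 1) T)))) - 1 / 2) -
          (γ / T ^ 2 * (∫ t in Set.Ioi (0 : ℝ),
            ((∫ z, (z.2 0) ^ 2 * (∫ y, (y.2 j) ^ 2
              ∂((Literature.MathematicalPhysics.KineticTheory.HeatConduction.pinnedChain ω₂ lam β γ).transitionKernel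
                (N + 1) T T t.toNNReal z))
              ∂((Literature.MathematicalPhysics.KineticTheory.HeatConduction.pinnedChain ω₂ lam β γ).gibbsMeasure
                (N + 1) T)) -
            (∫ z, (z.2 0) ^ 2
              ∂((Literature.MathematicalPhysics.KineticTheory.HeatConduction.pinnedChain ω₂ lam β γ).gibbsMeasure
                (N + 1) T)) *
              (∫ z, (∫ y, (y.2 j) ^ 2
                ∂((Literature.MathematicalPhysics.KineticTheory.HeatConduction.pinnedChain ω₂ lam β γ).transitionKernel
                  (N + 1) T T t.toNNReal z))
                ∂((Literature.MathematicalPhysics.KineticTheory.HeatConduction.pinnedChain ω₂ lam β γ).gibbsMeasure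
                  (N + 1) T)))) - 1 / 2) -
          r * ((γ ^ 2 / T ^ 2) * ∫ t in Set.Ioi (0 : ℝ),
            Summit.AtomisticToContinuum.FouriersLaw.Theorems.BoundaryKubo.Negative.LoadBearing.kuboIntegrand
              ω₂ lam β γ T N t)| ≤
        C * |((γ ^ 2 / T ^ 2) * ∫ t in Set.Ioi (0 : ℝ),
            Summit.AtomisticToContinuum.FouriersLaw.Theorems.BoundaryKubo.Negative.LoadBearing.kuboIntegrand
              ω₂ lam β γ T N t)| * θ ^ N) →
    Summit.AtomisticToContinuum.FouriersLaw.Theses.PuiseuxTransferLedger.TwoModeBulk := by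
  intro hL hB
  refine twoModeBulk_iff_twoModeProfile.mpr fun ω₂ lam β γ hω hl hβ hγ T hT => ?_
  exact twoMode_glue
    (fun N i => γ / T ^ 2 * (∫ t in Set.Ioi (0 : ℝ),
      ((∫ z, (z.2 0) ^ 2 * (∫ y, (y.2 i) ^ 2
        ∂((pinnedChain ω₂ lam β γ).transitionKernel (N + 1) T T t.toNNReal z))
        ∂((pinnedChain ω₂ lam β γ).gibbsMeasure (N + 1) T)) -
      (∫ z, (z.2 0) ^ 2 ∂((pinnedChain ω₂ lam β γ).gibbsMeasure (N + 1) T)) *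
        (∫ z, (∫ y, (y.2 i) ^ 2
          ∂((pinnedChain ω₂ lam β γ).transitionKernel (N + 1) T T t.toNNReal z))
          ∂((pinnedChain ω₂ lam β γ).gibbsMeasure (N + 1) T)))) - 1 / 2)
    (fun N => (γ ^ 2 / T ^ 2) * ∫ t in Set.Ioi (0 : ℝ), kuboIntegrand ω₂ lam β γ T N t)
    (hL ω₂ lam β γ hω hl hβ hγ T hT) (hB ω₂ lam β γ hω hl hβ hγ T hT)

end Summit.AtomisticToContinuum.FouriersLaw.Theorems.TwoModeBulk.Sketch

end
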